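import Summits.Ventures.CertifiedManyBodySolver.Observables.TIGroundStatePairLROCeilingAssembly

/-!
# The BCS-crutch SUSCEPTIBILITY theorem: the energy-gain slope of the crutch at `g = 0⁺` is the square
# of the Koma–Tasaki order parameter (thermodynamic limit)

Cell `hubbard-cq` (venture `CertifiedManyBodySolver`; card `bcs-crutch-odlro-floor` corollary column, TL
reading; transplant DICTIONARY BN-T1 made quantitative). Notation: `A_L(h) = dWaveSourceTorusTT' L t' U μ h`,
`E_L(h) = E₀(A_L(h))`, `e = dWaveSourceEnergyDensityTT' t' U μ` (`E_L/L² → e`, concave, antitone on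
`[0,∞)`), `∂⁺e(h) = derivWithin e (Ioi h) h`, `m⁺(h) = −∂⁺e(h)/2 ≥ 0` (`m⁺(0) = m⋆ =
dWaveOrderParameterTT' t' U μ`), `K_d = ‖P‖ = 2Σ_e|d(e)/√2|`, and the BCS-crutch energy density with base
field `e_L^cr(g, h₀) = E₀(A_L(h₀) − (g/L²)Δ_dᴴΔ_d)/L²`.

* `crutchEnergyDensity_eventually_le` — UPPER: for `h₀ ≥ 0`, `g > 0`, `δ > 0`, eventually in `L`:
  `e_L^cr(g,h₀) ≤ e(h₀) − g·m⁺(h₀)² + δ` (easy half of the AHM bound at the field `h₀ + g·m⁺(h₀)` + the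
  concavity tangent `e(h) ≤ e(h₀) + ∂⁺e(h₀)(h − h₀)`);
* `crutchEnergyDensity_eventually_ge` — LOWER: eventually `e_L^cr(g,h₀) ≥ e(h₀) − g·m⁺(h₀ + 2gK_d)² − δ`
  (the finite-volume sandwich `ahmTT'_sandwich` + `E_L/L² → e` + `limsup m_L ≤ m⁺`);
* **`crutch_susceptibility`** — for `h₀ ≥ 0` and `ε > 0` there is `g₀ > 0` such that for every
  `g ∈ (0, g₀)`, eventually in `L`: `|(e(h₀) − e_L^cr(g,h₀))/g − m⁺(h₀)²| ≤ ε` — the energy gained per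
  unit crutch coupling is, to first order in `g` and in the thermodynamic limit, EXACTLY the squared
  Griffiths response `m⁺(h₀)²` (right-continuity of `∂⁺e`, step (η));
* **`crutchTorusTT'_susceptibility`** — the zero-field case on the card's D1 object by name:
  `|(e(0) − E₀(crutchTorusTT' L t' U μ g)/L²)/g − (m⋆)²| ≤ ε` eventually, for all small `g` —
  **the BCS-crutch energy-gain slope at `g = 0⁺` equals `(m⋆)²`**, the square of the Koma–Tasaki `d`-wave
  order parameter.

READING: the crutch axis `g` carries, to first order, exactly the bit `m⋆` of the pinning-field axis and
nothing else (BN-T1 in the thermodynamic limit, both directions); a certified two-sided window on the crutch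
energy density of width `w` at coupling `g` brackets `(m⋆)²` only up to `w/g + o_g(1)`. This is the `T = 0`
shadow of the Bogoliubov Jr. / Bru–de Siqueira Pedra variational formula `p = sup_c (p̃(c) − |c|²)`.
HONEST SCOPE / WHAT THIS IS NOT: a statement about the BCS-crutch Hamiltonian's energy, not about the Hubbard
model's order (nothing at `g = 0` is FLOORED: `m⋆` enters squared as a SLOPE, readable only through a limit
`g → 0⁺` that no finite certificate takes); no phase sentence; grand-canonical at fixed `μ`.
Everything PROVED; no definition, no named fact; zero compute.

References: N. N. Bogolyubov Jr., Physica 32 (1966) 933, Thm 1; J.-B. Bru, W. de Siqueira Pedra, Mem. AMS 224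
(2013), Thm 2.12 / Appendix Thm 107; T. Koma, H. Tasaki, J. Stat. Phys. 76 (1994) §1; R. B. Griffiths, Phys.
Rev. 152 (1966) 240, §II.
-/

noncomputable section

namespace Summit.Ventures.CertifiedManyBodySolver.Observables.SourcedTorusAHM

open Matrix Finset Filter Topology Set Literature.MathematicalPhysics.QuantumLattice
open Literature.Probability.LatticeModels
open scoped ComplexOrder

/-- Concavity tangent of the sourced energy density: `e(h) ≤ e(h₀) + ∂⁺e(h₀)·(h − h₀)` for `h₀ ≤ h`.
Griffiths (1966) §II. -/
theorem dWaveSourceEnergyDensityTT'_le_tangent (tp U μ : ℝ) {h₀ h : ℝ} (hle : h₀ ≤ h) :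
    dWaveSourceEnergyDensityTT' tp U μ h ≤ dWaveSourceEnergyDensityTT' tp U μ h₀ +
      derivWithin (dWaveSourceEnergyDensityTT' tp U μ) (Ioi h₀) h₀ * (h - h₀) := by
  rcases hle.eq_or_lt with heq | hlt
  · rw [← heq, sub_self, mul_zero, add_zero]
  · have hs := (concaveOn_dWaveSourceEnergyDensityTT' tp U μ).slope_le_of_hasDerivWithinAt_Ioi
      (mem_univ h₀) (mem_univ h) hlt (hasDerivWithinAt_Ioi_Iio_dWaveSourceEnergyDensityTT' tp U μ h₀).1
    rw [slope_def_field, div_le_iff₀ (sub_pos.2 hlt)] at hs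
    linarith

/-- **UPPER BOUND on the crutch energy density, eventually in `L`**: for `h₀ ≥ 0`, `g > 0`, `δ > 0`,
eventually `E₀(A_L(h₀) − (g/L²)Δ_dᴴΔ_d)/L² ≤ e(h₀) − g·(∂⁺e(h₀)/2)² + δ` — the easy half of the
approximating-Hamiltonian bound at the field `h = h₀ − g∂⁺e(h₀)/2 ≥ h₀`, `E_L(h)/L² → e(h)` and the concavity
tangent. Bru–de Siqueira Pedra (2013) Thm 107 (lower-bound half). -/
theorem crutchEnergyDensity_eventually_le (tp U μ : ℝ) {h₀ g δ : ℝ} (hh₀ : 0 ≤ h₀) (hg : 0 < g)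
    (hδ : 0 < δ) :
    ∀ᶠ n : ℕ in atTop,
      (dWaveSourceTorusTT' (n + 1) tp U μ h₀ - ((g / (((n + 1 : ℕ) : ℝ)) ^ 2 : ℝ) : ℂ) •
          ((pairField dWaveFormFactor (n + 1))ᴴ * pairField dWaveFormFactor (n + 1))).groundEnergy /
          (((n + 1 : ℕ) : ℝ)) ^ 2 ≤
        dWaveSourceEnergyDensityTT' tp U μ h₀ -
          g * (derivWithin (dWaveSourceEnergyDensityTT' tp U μ) (Ioi h₀) h₀ / 2) ^ 2 + δ := by
  set a : ℝ := -derivWithin (dWaveSourceEnergyDensityTT' tp U μ) (Ioi h₀) h₀ / 2 with ha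
  have ha0 : 0 ≤ a := by
    have := rightDeriv_dWaveSourceEnergyDensityTT'_nonpos tp U μ hh₀
    rw [ha]; linarith
  have hsq : (derivWithin (dWaveSourceEnergyDensityTT' tp U μ) (Ioi h₀) h₀ / 2) ^ 2 = a ^ 2 := by
    rw [ha]; ring
  rw [hsq]
  -- the trial field `h = h₀ + g a`
  have htan := dWaveSourceEnergyDensityTT'_le_tangent tp U μ (h₀ := h₀) (h := h₀ + g * a)
    (le_add_of_nonneg_right (by positivity))
  have hD : derivWithin (dWaveSourceEnergyDensityTT' tp U μ) (Ioi h₀) h₀ = -2 * a := by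
    rw [ha]; ring
  rw [hD, add_sub_cancel_left] at htan
  -- `E_L(h)/L² ≤ e(h) + δ` eventually
  have ht := tendsto_dWaveSourceEnergyDensityTT' tp U μ (h₀ + g * a)
  have hev := ht.eventually (Iio_mem_nhds
    (show dWaveSourceEnergyDensityTT' tp U μ (h₀ + g * a) <
      dWaveSourceEnergyDensityTT' tp U μ (h₀ + g * a) + δ by linarith))
  filter_upwards [hev] with n hn
  have hn' : (dWaveSourceTorusTT' (n + 1) tp U μ (h₀ + g * a)).groundEnergy / (((n + 1 : ℕ) : ℝ)) ^ 2 <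
      dWaveSourceEnergyDensityTT' tp U μ (h₀ + g * a) + δ := hn
  have hV : (0 : ℝ) < (((n + 1 : ℕ) : ℝ)) ^ 2 := by positivity
  -- easy half at `h = h₀ + g a`, divided by `L²`
  have heasy := ahmTT'_groundEnergy_model_le (n + 1) tp U μ h₀ (h₀ + g * a) hg
  rw [add_sub_cancel_left] at heasy
  have heasy' := div_le_div_of_nonneg_right heasy hV.le
  have e1 : ((dWaveSourceTorusTT' (n + 1) tp U μ (h₀ + g * a)).groundEnergy +
        (g * a) ^ 2 * (((n + 1 : ℕ) : ℝ)) ^ 2 / g) / (((n + 1 : ℕ) : ℝ)) ^ 2 =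
      (dWaveSourceTorusTT' (n + 1) tp U μ (h₀ + g * a)).groundEnergy / (((n + 1 : ℕ) : ℝ)) ^ 2 +
        g * a ^ 2 := by
    field_simp
  rw [e1] at heasy'
  nlinarith [heasy', hn', htan]

/-- **LOWER BOUND on the crutch energy density, eventually in `L`**: for `h₀ ≥ 0`, `g > 0`, `δ > 0`,
eventually `e(h₀) − g·(∂⁺e(h₀ + 2gK_d)/2)² − δ ≤ E₀(A_L(h₀) − (g/L²)Δ_dᴴΔ_d)/L²` — the finite-volume
sandwich `ahmTT'_sandwich` (Bogoliubov Jr.'s hard half), `E_L/L² → e` and `limsup_L m_L ≤ −∂⁺e/2`.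
Bogolyubov Jr. et al. (1984); Bru–de Siqueira Pedra (2013) Thm 107 (ii). -/
theorem crutchEnergyDensity_eventually_ge (tp U μ : ℝ) {h₀ g δ : ℝ} (hh₀ : 0 ≤ h₀) (hg : 0 < g)
    (hδ : 0 < δ) :
    ∀ᶠ n : ℕ in atTop,
      dWaveSourceEnergyDensityTT' tp U μ h₀ -
          g * (derivWithin (dWaveSourceEnergyDensityTT' tp U μ)
            (Ioi (h₀ + 2 * g * (2 * ∑ e ∈ insert (0 : Site 2) unitSteps, |dWaveFormFactor e / Real.sqrt 2|)))
            (h₀ + 2 * g * (2 * ∑ e ∈ insert (0 : Site 2) unitSteps, |dWaveFormFactor e / Real.sqrt 2|)) /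
            2) ^ 2 - δ ≤
        (dWaveSourceTorusTT' (n + 1) tp U μ h₀ - ((g / (((n + 1 : ℕ) : ℝ)) ^ 2 : ℝ) : ℂ) •
          ((pairField dWaveFormFactor (n + 1))ᴴ * pairField dWaveFormFactor (n + 1))).groundEnergy /
          (((n + 1 : ℕ) : ℝ)) ^ 2 := by
  have hK0 : (0 : ℝ) ≤ 2 * ∑ e ∈ insert (0 : Site 2) unitSteps, |dWaveFormFactor e / Real.sqrt 2| := by
    positivity
  have hx0 : 0 ≤ h₀ + 2 * g * (2 * ∑ e ∈ insert (0 : Site 2) unitSteps, |dWaveFormFactor e / Real.sqrt 2|) := by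
    have : 0 ≤ 2 * g * (2 * ∑ e ∈ insert (0 : Site 2) unitSteps, |dWaveFormFactor e / Real.sqrt 2|) := by
      positivity
    linarith
  -- the sandwich at accuracy `δ/3`
  obtain ⟨L₀, hL₀⟩ := (ahmTT'_sandwich tp U g |μ| h₀ hg).2 (δ / 3) (by positivity)
  have hlow : ∀ᶠ n : ℕ in atTop,
      (dWaveSourceTorusTT' (n + 1) tp U μ h₀).groundEnergy / (((n + 1 : ℕ) : ℝ)) ^ 2 -
            g * dWaveSourceDensityTT' (n + 1) tp U μ (h₀ + 2 * g *
              (2 * ∑ e ∈ insert (0 : Site 2) unitSteps, |dWaveFormFactor e / Real.sqrt 2|)) ^ 2 -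
          δ / 3 ≤
        (dWaveSourceTorusTT' (n + 1) tp U μ h₀ - ((g / (((n + 1 : ℕ) : ℝ)) ^ 2 : ℝ) : ℂ) •
            ((pairField dWaveFormFactor (n + 1))ᴴ * pairField dWaveFormFactor (n + 1))).groundEnergy /
          (((n + 1 : ℕ) : ℝ)) ^ 2 :=
    eventually_atTop.2 ⟨L₀, fun n hn => hL₀ (n + 1) (by omega) μ le_rfl h₀ hh₀ le_rfl⟩
  -- `m_L(x)² ≤ (∂⁺e(x)/2)² + δ/(3g)` eventually
  have hdens := eventually_sq_dWaveSourceDensityTT'_le tp U μ hx0 (δ := δ / (3 * g)) (by positivity)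
  -- `E_L(h₀)/L² ≥ e(h₀) − δ/3` eventually
  have ht := tendsto_dWaveSourceEnergyDensityTT' tp U μ h₀
  have hconv := ht.eventually (Ioi_mem_nhds
    (show dWaveSourceEnergyDensityTT' tp U μ h₀ - δ / 3 < dWaveSourceEnergyDensityTT' tp U μ h₀ by linarith))
  filter_upwards [hlow, hdens, hconv] with n hl hd hc
  have hc' : dWaveSourceEnergyDensityTT' tp U μ h₀ - δ / 3 <
      (dWaveSourceTorusTT' (n + 1) tp U μ h₀).groundEnergy / (((n + 1 : ℕ) : ℝ)) ^ 2 := hc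
  have hgd : g * (dWaveSourceDensityTT' (n + 1) tp U μ (h₀ + 2 * g *
      (2 * ∑ e ∈ insert (0 : Site 2) unitSteps, |dWaveFormFactor e / Real.sqrt 2|)) ^ 2) ≤
      g * ((derivWithin (dWaveSourceEnergyDensityTT' tp U μ)
        (Ioi (h₀ + 2 * g * (2 * ∑ e ∈ insert (0 : Site 2) unitSteps, |dWaveFormFactor e / Real.sqrt 2|)))
        (h₀ + 2 * g * (2 * ∑ e ∈ insert (0 : Site 2) unitSteps, |dWaveFormFactor e / Real.sqrt 2|)) / 2) ^ 2 +
        δ / (3 * g)) := mul_le_mul_of_nonneg_left hd hg.le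
  have e1 : g * (δ / (3 * g)) = δ / 3 := by field_simp
  rw [mul_add, e1] at hgd
  linarith

/-- **THE CRUTCH SUSCEPTIBILITY THEOREM**: for `h₀ ≥ 0` and `ε > 0` there is `g₀ > 0` such that for every
coupling `0 < g < g₀`, eventually in `L`,
`|(e(h₀) − E₀(A_L(h₀) − (g/L²)Δ_dᴴΔ_d)/L²)/g − (∂⁺e(h₀)/2)²| ≤ ε`:
the energy gained per unit BCS-crutch coupling is, to first order in `g` (thermodynamic limit first), EXACTLY
the squared Griffiths response `m⁺(h₀)² = (∂⁺e(h₀)/2)²`. Upper and lower bounds above + right-continuity of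
`∂⁺e` (step (η), `exists_sq_half_rightDeriv_le_add`). Bru–de Siqueira Pedra (2013) Thm 2.12 / Thm 107 at
`T = 0`; Koma–Tasaki (1994) §1. -/
theorem crutch_susceptibility (tp U μ : ℝ) {h₀ : ℝ} (hh₀ : 0 ≤ h₀) {ε : ℝ} (hε : 0 < ε) :
    ∃ g₀ : ℝ, 0 < g₀ ∧ ∀ g : ℝ, 0 < g → g < g₀ → ∀ᶠ n : ℕ in atTop,
      |(dWaveSourceEnergyDensityTT' tp U μ h₀ -
            (dWaveSourceTorusTT' (n + 1) tp U μ h₀ - ((g / (((n + 1 : ℕ) : ℝ)) ^ 2 : ℝ) : ℂ) •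
              ((pairField dWaveFormFactor (n + 1))ᴴ * pairField dWaveFormFactor (n + 1))).groundEnergy /
              (((n + 1 : ℕ) : ℝ)) ^ 2) / g -
          (derivWithin (dWaveSourceEnergyDensityTT' tp U μ) (Ioi h₀) h₀ / 2) ^ 2| ≤ ε := by
  have hK0 : (0 : ℝ) ≤ 2 * ∑ e ∈ insert (0 : Site 2) unitSteps, |dWaveFormFactor e / Real.sqrt 2| := by
    positivity
  obtain ⟨u, hu0, hu⟩ := exists_sq_half_rightDeriv_le_add tp U μ h₀ (ε := ε / 2) (by positivity)
  refine ⟨u / (2 * (2 * ∑ e ∈ insert (0 : Site 2) unitSteps, |dWaveFormFactor e / Real.sqrt 2|) + 1),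
    by positivity, fun g hg hgu => ?_⟩
  -- `x = h₀ + 2gK_d < h₀ + u`
  have h2gK : 2 * g * (2 * ∑ e ∈ insert (0 : Site 2) unitSteps, |dWaveFormFactor e / Real.sqrt 2|) < u := by
    set K : ℝ := 2 * ∑ e ∈ insert (0 : Site 2) unitSteps, |dWaveFormFactor e / Real.sqrt 2| with hK
    have h1 : g * (2 * K + 1) < u := by rwa [lt_div_iff₀ (by positivity)] at hgu
    nlinarith
  have h2gK0 : 0 ≤ 2 * g * (2 * ∑ e ∈ insert (0 : Site 2) unitSteps, |dWaveFormFactor e / Real.sqrt 2|) := by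
    positivity
  have ha := hu (h₀ + 2 * g * (2 * ∑ e ∈ insert (0 : Site 2) unitSteps, |dWaveFormFactor e / Real.sqrt 2|))
    (by linarith) (by linarith)
  have hup := crutchEnergyDensity_eventually_le tp U μ hh₀ hg (δ := g * ε / 2) (by positivity)
  have hlow := crutchEnergyDensity_eventually_ge tp U μ hh₀ hg (δ := g * ε / 2) (by positivity)
  filter_upwards [hup, hlow] with n hnu hnl
  rw [abs_le]
  constructor
  · -- lower: from the upper bound on the crutch energy
    rw [le_sub_iff_add_le, le_div_iff₀ hg]
    nlinarith [hnu]
  · -- upper: from the lower bound on the crutch energy and the right-continuity of `∂⁺e`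
    rw [sub_le_iff_le_add, div_le_iff₀ hg]
    have hga := mul_le_mul_of_nonneg_left ha hg.le
    nlinarith [hnl, hga]

/-- **The zero-field case on the card's D1 object, by name** (`crutchTorusTT'` of
`Observables/CrutchODLROFloor.lean`): for `ε > 0` there is `g₀ > 0` such that for every `0 < g < g₀`,
eventually in `L`, `|(e(0) − E₀(crutchTorusTT' L t' U μ g)/L²)/g − (m⋆)²| ≤ ε`, `m⋆ =
dWaveOrderParameterTT' t' U μ`: **the BCS-crutch energy-gain slope at `g = 0⁺` is the square of the
Koma–Tasaki `d`-wave order parameter.** Koma–Tasaki (1994) §1; Bru–de Siqueira Pedra (2013) Thm 2.12. -/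
theorem crutchTorusTT'_susceptibility (tp U μ : ℝ) {ε : ℝ} (hε : 0 < ε) :
    ∃ g₀ : ℝ, 0 < g₀ ∧ ∀ g : ℝ, 0 < g → g < g₀ → ∀ᶠ n : ℕ in atTop,
      |(dWaveSourceEnergyDensityTT' tp U μ 0 -
            (crutchTorusTT' (n + 1) tp U μ g).groundEnergy / (((n + 1 : ℕ) : ℝ)) ^ 2) / g -
          dWaveOrderParameterTT' tp U μ ^ 2| ≤ ε := by
  obtain ⟨g₀, hg₀, h⟩ := crutch_susceptibility tp U μ le_rfl hε
  refine ⟨g₀, hg₀, fun g hg hgg => ?_⟩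
  have hsq : (derivWithin (dWaveSourceEnergyDensityTT' tp U μ) (Ioi 0) 0 / 2) ^ 2 =
      dWaveOrderParameterTT' tp U μ ^ 2 := by
    rw [dWaveOrderParameterTT'_eq_neg_half_rightDeriv]; ring
  filter_upwards [h g hg hgg] with n hn
  rwa [crutchTorusTT'_eq_model, ← hsq]

end Summit.Ventures.CertifiedManyBodySolver.Observables.SourcedTorusAHM

end
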